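import Summits.CriticalPhenomena.Ising3DConformalLimit.Theorems.GaussianLimitNotScreened.Negative.ModelBlind

/-!
# `GaussianLimitNotScreened` (stmt-CriticalPhenomena-13886): sharpened model-blindness and refuted
# strengthenings

Negative knowledge about the crux `…Theses.PerfectScreening.GaussianLimitNotScreened` (r4 of route
PerfectScreening), standing crux disprover (D-0016); supports the item, closes nothing. Continues
`Negative/ModelBlind.lean` (the screened Wick witness `screenedLattice` with free-field limit):

* `cruxWithoutIsingSharp_false` — the model-blind crux stays FALSE for lattice families that are
  translation invariant, pair-symmetric, Gaussian ON THE LATTICE (Wick identity at order 4), odd-free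
  and inside the Ising two-point window `c‖x‖⁻² ≤ G₂(0,x) ≤ C‖x‖⁻¹` (`screenedLattice_window`, the
  shape of the tree fact `criticalTwoPoint_bounds` at `d = 3`): none of these is the missing lever.
* `not_coulombWithoutIsing` — the model-blind rev-3 strong form (`GaussianLimitIsCoulomb`) is false.
* `renorm_not_canonical` — the witness' `ρ(δ)²δ = 1 - log δ → ∞`.
* `not_halfOne_blind`, `not_halfTwo_blind` — each half of the decomposition
  `crux ↔ (Δ = 1/2) ∧ (Z_m ↛ 0)` (`Negative/Reformulation.lean`) is model-blind-false on its own
  (witnesses: the sampled generalised free field `gffLattice (3/5)`; `screenedLattice`).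
-/

noncomputable section

namespace Summit.CriticalPhenomena.Ising3DConformalLimit.GaussianLimitNotScreenedNegative

open Literature.Probability.LatticeModels Filter Topology Metric
open Literature.Barriers.CriticalPhenomena.ScaleNotMoebius (tendstoLocallyUniformlyOn_comp_approx tendstoLocallyUniformlyOn_congr_eventually)

/-! ## (a2) Sharpened model-blindness: Ising-like two-point and algebraic structure does not help

The witness shares with `criticalCorr 3` every structural property that enters the route's
discussion of r4 at the two- and four-point level: lattice translation invariance, pair symmetry,
lattice Gaussianity (`U₄^{ℤ³} ≡ 0`, stronger than Gaussianity of the limit), vanishing odd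
correlators, and the Simon–Lieb / infrared-bound window `c‖x‖⁻² ≤ G₂(0,x) ≤ C‖x‖⁻¹` of
`criticalTwoPoint_bounds` (d = 3). So none of these can be the missing lever. -/

/-- `ι` is additive. [folklore] -/
theorem ι_add (a b : Site 3) : ι (a + b) = ι a + ι b := by
  ext j; simp [ι]

/-- The kernel is translation invariant. [folklore] -/
theorem gL_add (a b v : Site 3) : gL (a + v) (b + v) = gL a b := by
  simp only [gL, ι_add, add_sub_add_right_eq_sub]

/-- The kernel is symmetric. [folklore] -/
theorem gL_comm (a b : Site 3) : gL a b = gL b a := by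
  rw [gL, gL, norm_sub_rev]

/-- Lattice translation invariance of the witness. [folklore] -/
theorem screenedLattice_translation (n : ℕ) (v : Site 3) (y : Fin n → Site 3) :
    screenedLattice n (fun i => y i + v) = screenedLattice n y := by
  match n with
  | 0 => rfl
  | 1 => rfl
  | 2 => simp [screenedLattice, wickFamily, gL_add]
  | 3 => rfl
  | 4 => simp [screenedLattice, wickFamily, gL_add]
  | _ + 5 => rfl

/-- Pair symmetry of the witness. [folklore] -/
theorem screenedLattice_symm (a b : Site 3) : screenedLattice 2 ![a, b] = screenedLattice 2 ![b, a] := by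
  simp [screenedLattice, wickFamily, gL_comm]

/-- Lattice Gaussianity of the witness: the Wick identity holds ON `ℤ³` (all configurations). [folklore] -/
theorem screenedLattice_wick (y : Fin 4 → Site 3) :
    screenedLattice 4 y = screenedLattice 2 ![y 0, y 1] * screenedLattice 2 ![y 2, y 3] +
      screenedLattice 2 ![y 0, y 2] * screenedLattice 2 ![y 1, y 3] +
      screenedLattice 2 ![y 0, y 3] * screenedLattice 2 ![y 1, y 2] := by
  simp [screenedLattice, wickFamily]

/-- Odd correlators of the witness vanish. [folklore] -/
theorem screenedLattice_odd (n : ℕ) (hn : Odd n) (y : Fin n → Site 3) : screenedLattice n y = 0 := by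
  match n, hn with
  | 0, hn => exact absurd hn (by decide)
  | 1, _ => rfl
  | 2, hn => exact absurd hn (by decide)
  | 3, _ => rfl
  | 4, hn => exact absurd hn (by decide)
  | _ + 5, _ => rfl

/-- Euclidean norm ≤ √3 · sup norm for integer points (`‖ι x‖² ≤ 3‖x‖²`). [folklore] -/
theorem norm_ι_sq_le (x : Site 3) : ‖ι x‖ ^ 2 ≤ 3 * ‖x‖ ^ 2 := by
  rw [EuclideanSpace.norm_eq, Real.sq_sqrt (Finset.sum_nonneg fun _ _ => sq_nonneg _)]
  calc ∑ j, ‖(ι x) j‖ ^ 2 ≤ ∑ _j : Fin 3, ‖x‖ ^ 2 := by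
        refine Finset.sum_le_sum fun j _ => ?_
        have h : ‖(ι x) j‖ = ‖x j‖ := by rw [ι_apply, Int.norm_cast_real]
        rw [h]
        exact pow_le_pow_left₀ (norm_nonneg _) (norm_le_pi_norm x j) 2
    _ = 3 * ‖x‖ ^ 2 := by simp

/-- **The witness lies in the Ising two-point window** `(1/3)‖x‖⁻² ≤ G₂(0,x) ≤ ‖x‖⁻¹` (`x ≠ 0`,
sup norm, real powers) — the exact shape of the tree fact `criticalTwoPoint_bounds` at `d = 3`
(Simon–Lieb lower bound, Fröhlich–Simon–Spencer infrared upper bound). [folklore] -/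
theorem screenedLattice_window :
    ∃ c C : ℝ, 0 < c ∧ ∀ x : Site 3, x ≠ 0 →
      c * ‖x‖ ^ (-(2:ℝ)) ≤ screenedLattice 2 ![0, x] ∧ screenedLattice 2 ![0, x] ≤ C * ‖x‖ ^ (-(1:ℝ)) := by
  refine ⟨1/3, 1, by norm_num, fun x hx => ?_⟩
  have ht : (1:ℝ) ≤ ‖x‖ := by
    obtain ⟨j, hj⟩ : ∃ j, x j ≠ 0 := by
      by_contra hall; push Not at hall; exact hx (funext hall)
    calc (1 : ℝ) ≤ ‖x j‖ := by rw [Int.norm_eq_abs]; exact_mod_cast Int.one_le_abs hj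
      _ ≤ ‖x‖ := norm_le_pi_norm x j
  have ht0 : (0:ℝ) < ‖x‖ := by linarith
  have hr1 : 1 ≤ ‖ι x‖ := one_le_norm_ι hx
  have hr0 : 0 < ‖ι x‖ := by linarith
  have hlog0 : 0 ≤ Real.log ‖ι x‖ := Real.log_nonneg hr1
  have hlog1 : 1 + Real.log ‖ι x‖ ≤ ‖ι x‖ := by
    have := Real.log_le_sub_one_of_pos hr0; linarith
  rw [screenedLattice_two, phi, Real.rpow_neg ht0.le, Real.rpow_two, Real.rpow_neg_one]
  constructor
  · -- (1/3) (‖x‖²)⁻¹ ≤ r⁻¹ (1 + log r)⁻¹  ⟸  r (1 + log r) ≤ r² ≤ 3 ‖x‖²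
    have hsq := norm_ι_sq_le x
    have hden : 0 < ‖ι x‖ * (1 + Real.log ‖ι x‖) := by positivity
    rw [← mul_inv, show (1/3 : ℝ) * (‖x‖ ^ 2)⁻¹ = (3 * ‖x‖ ^ 2)⁻¹ by rw [mul_inv]; norm_num]
    apply inv_anti₀ hden
    nlinarith
  · -- r⁻¹ (1 + log r)⁻¹ ≤ ‖x‖⁻¹
    have h1 : ‖ι x‖⁻¹ ≤ ‖x‖⁻¹ := inv_anti₀ ht0 (norm_le_norm_ι x)
    have h2 : (1 + Real.log ‖ι x‖)⁻¹ ≤ 1 := inv_le_one_of_one_le₀ (by linarith)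
    have h3 : 0 ≤ (1 + Real.log ‖ι x‖)⁻¹ := inv_nonneg.2 (by linarith)
    calc ‖ι x‖⁻¹ * (1 + Real.log ‖ι x‖)⁻¹ ≤ ‖x‖⁻¹ * 1 := by gcongr
      _ = 1 * ‖x‖⁻¹ := by ring

/-- The sharpened model-blind crux: as `CruxWithoutIsing`, but only for lattice families that are
translation invariant, pair-symmetric, Gaussian ON THE LATTICE (Wick identity at order 4), have
vanishing odd correlators and obey the Ising two-point window `c‖x‖⁻² ≤ G₂(0,x) ≤ C‖x‖⁻¹`. [folklore] -/
def CruxWithoutIsingSharp : Prop :=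
  ∀ (G : LatticeCorrFamily 3),
    (∀ n (v : Site 3) (y : Fin n → Site 3), G n (fun i => y i + v) = G n y) →
    (∀ a b : Site 3, G 2 ![a, b] = G 2 ![b, a]) →
    (∀ y : Fin 4 → Site 3, G 4 y = G 2 ![y 0, y 1] * G 2 ![y 2, y 3] +
      G 2 ![y 0, y 2] * G 2 ![y 1, y 3] + G 2 ![y 0, y 3] * G 2 ![y 1, y 2]) →
    (∀ n, Odd n → ∀ y : Fin n → Site 3, G n y = 0) →
    (∃ c C : ℝ, 0 < c ∧ ∀ x : Site 3, x ≠ 0 →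
      c * ‖x‖ ^ (-(2:ℝ)) ≤ G 2 ![0, x] ∧ G 2 ![0, x] ≤ C * ‖x‖ ^ (-(1:ℝ))) →
    ∀ (ρ : ℝ → ℝ) (Δ : ℝ) (S : CorrFamily 3), (∀ δ ∈ Set.Ioc (0:ℝ) 1, 0 < ρ δ) →
    HasPointwiseScalingLimit G ρ S → IsNondegenerateTwoPoint S → IsMoebiusCovariant Δ S →
    ¬ HasNontrivialU4 S →
    ¬ Tendsto (fun x : Site 3 => ‖x‖ * G 2 ![0, x]) cofinite (𝓝 0)

/-- `CruxWithoutIsing → CruxWithoutIsingSharp` (the sharp form has more hypotheses). [folklore] -/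
theorem cruxWithoutIsingSharp_of_cruxWithoutIsing (h : CruxWithoutIsing) : CruxWithoutIsingSharp :=
  fun G _ _ _ _ _ ρ Δ S hρ hlim hnd hM hU4 => h G ρ Δ S hρ hlim hnd hM hU4

/-- **`¬ CruxWithoutIsingSharp`**: even among translation-invariant, lattice-Gaussian, odd-free lattice
families inside the Ising two-point window, "non-degenerate Möbius Gaussian limit ⇒ not screened"
FAILS (same witness). So a proof of r4 must use something finer than: Gaussianity (on the lattice or
in the limit), Möbius covariance / `Δ = 1/2` rigidity of the limit, translation invariance, and the
Simon–Lieb/FSS decay window — i.e. exactly the 'amplitude rigidity' the planner flagged as having no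
known handle, which must come from the nearest-neighbour DLR structure of the Ising MEASURE. [folklore] -/
theorem cruxWithoutIsingSharp_false : ¬ CruxWithoutIsingSharp := by
  intro h
  exact h screenedLattice screenedLattice_translation screenedLattice_symm screenedLattice_wick
    screenedLattice_odd screenedLattice_window renorm (1/2) (gffFamily (1/2))
    (fun δ hδ => renorm_pos hδ.1 hδ.2) screenedLattice_hasLimit (isNondegenerateTwoPoint_gff _)
    (isMoebiusCovariant_gff _) (not_hasNontrivialU4_gff _) screenedLattice_screened

/-- STRENGTHENING 2 (model-blind rev-3 strong form): the model-blind `GaussianLimitIsCoulomb`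
(conclusion `∃ c > 0, c/‖x‖ ≤ G₂(0,x)`) is FALSE as well (it implies the model-blind crux). [folklore] -/
theorem not_coulombWithoutIsing :
    ¬ ∀ (G : LatticeCorrFamily 3) (ρ : ℝ → ℝ) (Δ : ℝ) (S : CorrFamily 3), (∀ δ ∈ Set.Ioc (0:ℝ) 1, 0 < ρ δ) →
      HasPointwiseScalingLimit G ρ S → IsNondegenerateTwoPoint S → IsMoebiusCovariant Δ S →
      ¬ HasNontrivialU4 S → ∃ c : ℝ, 0 < c ∧ ∀ x : Site 3, x ≠ 0 → c / ‖x‖ ≤ G 2 ![0, x] := by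
  intro h
  obtain ⟨c, hc, hcoul⟩ := h screenedLattice renorm (1/2) (gffFamily (1/2))
    (fun δ hδ => renorm_pos hδ.1 hδ.2) screenedLattice_hasLimit (isNondegenerateTwoPoint_gff _)
    (isMoebiusCovariant_gff _) (not_hasNontrivialU4_gff _)
  have hev : ∀ᶠ x : Site 3 in cofinite, ‖x‖ * screenedLattice 2 ![0, x] < c :=
    (tendsto_order.1 screenedLattice_screened).2 c hc
  have hne : ∀ᶠ x : Site 3 in cofinite, x ≠ 0 := by
    have : {x : Site 3 | x ≠ 0}ᶜ.Finite := by simp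
    exact this
  obtain ⟨x, hx, hx0⟩ := (hev.and hne).exists
  have hxn : 0 < ‖x‖ := norm_pos_iff.2 hx0
  have := hcoul x hx0
  rw [div_le_iff₀ hxn] at this
  linarith [mul_comm ‖x‖ (screenedLattice 2 ![0, x])]

/-- STRENGTHENING 3 (drop `Δ`-freedom: insist on the canonical `Δ = 1/2` AND `ρ δ = δ^{-1/2}` exactly):
with the CANONICAL renormalisation the model-blind statement becomes TRUE trivially-by-contrapositive?
No — record instead the positive fact behind the crux's last step: if `ρ δ = δ^{-1/2}` is admissible
for the witness' limit then the two-point function is NOT screened. For `screenedLattice` the canonical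
renormalisation gives the ZERO two-point limit (the amplitude `(1 + log(r/δ))⁻¹ → 0`), i.e. the
screening is carried entirely by the slowly varying factor `√(log(e/δ))` in `renorm`. [folklore] -/
theorem renorm_not_canonical :
    Tendsto (fun δ : ℝ => renorm δ ^ 2 / δ⁻¹) (𝓝[>] 0) atTop := by
  have hev : ∀ᶠ δ in 𝓝[>] (0:ℝ), renorm δ ^ 2 / δ⁻¹ = 1 - Real.log δ := by
    filter_upwards [Ioc_mem_nhdsGT (zero_lt_one' ℝ)] with δ hδ
    rw [renorm_sq hδ.1 hδ.2, div_inv_eq_mul, div_mul_cancel₀ _ hδ.1.ne']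
  exact (tendsto_level.congr' (hev.mono fun δ h => h.symm))


/-! ## (d2) Both halves of the decomposition are individually MODEL-BLIND-FALSE

Half (i) ('a Gaussian Möbius limit has `Δ = 1/2`') fails for the lattice sampling of the generalised
free field `gffFamily Δ`, `Δ ∈ (1/2, 3/4)` (the LongRangeTrivialityOnZ3 phenomenon in its barest form);
half (ii) ('at `Δ = 1/2`, `Z_m ↛ 0`') fails for `screenedLattice`. So EACH half needs the Ising measure. -/

/-- The generalised free field sampled on `ℤ³`. [folklore] -/
def gffLattice (Δ : ℝ) : LatticeCorrFamily 3 := fun n y => gffFamily Δ n fun i => ι (y i)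

/-- `gffTwo Δ` of a pair picked from a configuration is continuous off the diagonals. [folklore] -/
theorem continuousOn_gffTwo_pair (Δ : ℝ) {n : ℕ} {i j : Fin n} (hij : i ≠ j) :
    ContinuousOn (fun z : Fin n → EuclideanSpace ℝ (Fin 3) => gffTwo Δ (z i) (z j)) (NonCoincident 3 n) := by
  unfold gffTwo
  refine ContinuousOn.rpow_const (((continuous_apply i).sub (continuous_apply j)).norm.continuousOn) ?_
  intro z hz
  exact Or.inl (norm_ne_zero_iff.2 (sub_ne_zero.2 fun h => hij (((mem_nonCoincident z).1 hz) h)))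

/-- The generalised free family is continuous on non-coincident configurations. [folklore] -/
theorem continuousOn_gffFamily (Δ : ℝ) : ∀ n, ContinuousOn (gffFamily Δ n) (NonCoincident 3 n)
  | 0 => continuousOn_const
  | 1 => continuousOn_const
  | 2 => continuousOn_gffTwo_pair Δ (by decide : (0 : Fin 2) ≠ 1)
  | 3 => continuousOn_const
  | 4 => ((continuousOn_gffTwo_pair Δ (by decide : (0 : Fin 4) ≠ 1)).mul
        (continuousOn_gffTwo_pair Δ (by decide : (2 : Fin 4) ≠ 3))).add
      ((continuousOn_gffTwo_pair Δ (by decide : (0 : Fin 4) ≠ 2)).mul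
        (continuousOn_gffTwo_pair Δ (by decide : (1 : Fin 4) ≠ 3))) |>.add
      ((continuousOn_gffTwo_pair Δ (by decide : (0 : Fin 4) ≠ 3)).mul
        (continuousOn_gffTwo_pair Δ (by decide : (1 : Fin 4) ≠ 2)))
  | _ + 5 => continuousOn_const

/-- The sampled generalised free field has itself as pointwise scaling limit (`ρ δ = δ^{-Δ}`). [folklore] -/
theorem gffLattice_hasLimit (Δ : ℝ) :
    HasPointwiseScalingLimit (gffLattice Δ) (fun δ => δ ^ (-Δ)) (gffFamily Δ) := by
  intro n
  have key : ∀ δ, 0 < δ → ∀ x : Fin n → EuclideanSpace ℝ (Fin 3),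
      rescaledCorrelator (gffLattice Δ) (fun δ => δ ^ (-Δ)) n δ x = gffFamily Δ n (roundCfg δ x) := by
    intro δ hδ x
    rw [rescaledCorrelator_apply]
    show (δ ^ (-Δ)) ^ n * gffFamily Δ n (fun i => ι (latticeApprox δ (x i))) =
      gffFamily Δ n (fun i => δ • ι (latticeApprox δ (x i)))
    rw [isScaleCovariant_gff Δ n δ hδ]
    congr 1
    rw [← Real.rpow_natCast, ← Real.rpow_mul hδ.le]
    congr 1; ring
  have happrox := tendstoLocallyUniformlyOn_comp_approx (isOpen_nonCoincident 3 n)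
    (continuousOn_gffFamily Δ n) (fun δ x => roundCfg δ x) 3 (fun _ hδ x => dist_roundCfg_le hδ x)
  refine tendstoLocallyUniformlyOn_congr_eventually happrox ?_
  filter_upwards [self_mem_nhdsWithin] with δ hδ x _
  exact (key δ hδ x).symm

/-- **Half (i) is model-blind-false**: a non-degenerate Möbius Gaussian pointwise limit of a lattice
family need not have `Δ = 1/2` (witness: `gffLattice (3/5)`, inside the Ising window `[1/2, 3/4]`). [folklore] -/
theorem not_halfOne_blind :
    ¬ ∀ (G : LatticeCorrFamily 3) (ρ : ℝ → ℝ) (Δ : ℝ) (S : CorrFamily 3), (∀ δ ∈ Set.Ioc (0:ℝ) 1, 0 < ρ δ) →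
      HasPointwiseScalingLimit G ρ S → IsNondegenerateTwoPoint S → IsMoebiusCovariant Δ S →
      ¬ HasNontrivialU4 S → Δ = 1/2 := by
  intro h
  have := h (gffLattice (3/5)) (fun δ => δ ^ (-(3/5:ℝ))) (3/5) (gffFamily (3/5))
    (fun δ hδ => Real.rpow_pos_of_pos hδ.1 _) (gffLattice_hasLimit _) (isNondegenerateTwoPoint_gff _)
    (isMoebiusCovariant_gff _) (not_hasNontrivialU4_gff _)
  norm_num at this

/-- **Half (ii) is model-blind-false**: at `Δ = 1/2`, a non-degenerate Möbius Gaussian pointwise limit of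
a lattice family may come with `ρ(1/m)²/m → ∞` (witness: `screenedLattice`, `ρ(1/m)²/m = 1 + log m`). [folklore] -/
theorem not_halfTwo_blind :
    ¬ ∀ (G : LatticeCorrFamily 3) (ρ : ℝ → ℝ) (S : CorrFamily 3), (∀ δ ∈ Set.Ioc (0:ℝ) 1, 0 < ρ δ) →
      HasPointwiseScalingLimit G ρ S → IsNondegenerateTwoPoint S → IsMoebiusCovariant (1/2) S →
      ¬ HasNontrivialU4 S → ¬ Tendsto (fun m : ℕ => ρ (1 / m) ^ 2 / m) atTop atTop := by
  intro h
  refine h screenedLattice renorm (gffFamily (1/2)) (fun δ hδ => renorm_pos hδ.1 hδ.2)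
    screenedLattice_hasLimit (isNondegenerateTwoPoint_gff _) (isMoebiusCovariant_gff _)
    (not_hasNontrivialU4_gff _) ?_
  have h1 : Tendsto (fun m : ℕ => 1 + Real.log m) atTop atTop :=
    tendsto_atTop_add_const_left _ 1 (Real.tendsto_log_atTop.comp tendsto_natCast_atTop_atTop)
  refine h1.congr' ?_
  filter_upwards [eventually_ge_atTop 1] with m hm
  have hm0 : (0:ℝ) < m := by exact_mod_cast hm
  have hm1 : (1:ℝ) / m ≤ 1 := by rw [div_le_one hm0]; exact_mod_cast hm
  rw [renorm_sq (by positivity) hm1, Real.log_div one_ne_zero hm0.ne', Real.log_one]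
  field_simp
  ring

end Summit.CriticalPhenomena.Ising3DConformalLimit.GaussianLimitNotScreenedNegative

end
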